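import Summits.AtomisticToContinuum.HydrodynamicLimit.Theorems.AntiMazurCoboundariesCorrectorPressureDecayKiferEntropyBoundAffinity
import Summits.AtomisticToContinuum.HydrodynamicLimit.Theorems.AntiMazurCoboundariesCorrectorPressureDecayKiferActivityBound

/-!
# Entropy bound for tangent states, V: the GIBBS-REFERENCE forms of the local-limit entropy bounds (line `FirstLemma`, crux stmt-AtomisticToContinuum-14135)

Helper file of the registered stub `stub_tangentEntropyBoundUniform : TangentEntropyBoundUniform` of line `FirstLemma`
(idea `kifer-compactification`), namespace `Summit.AtomisticToContinuum.HydrodynamicLimit.Theorems.KiferCompactification`; lead c8,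
after the wave-1 audit of the uniform bound (worker W5, p155992).

RESHAPE RECORDED HERE (nothing downstream is lost). `TangentEntropyBoundLocal` / `TangentEntropyBoundUniform`
(…KiferEntropyBound.lean, …KiferEntropyBoundAffinity.lean) take as reference ANY translation-invariant probability law `G` that is the
setwise local limit of the x-averaged blown-up canonical laws along `ι`. The audit found that every proof must then reproduce the
exact bulk free-energy cancellation between the canonical law and its local limit WITHOUT using any structure of `G` — whereas at the
line's only call site (`tangentEntropyLowDensity_of_localLimit`, …KiferEntropyViaLocalLimit / skeleton v10) the reference comes from
Georgii's fact together with an activity `z > 0`, the DLR property `IsHardSphereGibbs 1 z θ⁻¹ u₀ G` and the density `density G = σ³`.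
Adding these as HYPOTHESES is free there and makes the last step of the intended proof (comparison of the free grand-canonical block
reference with `G` through the DLR equations) an M-sized lemma. Hence the Gibbs-reference forms

* `TangentEntropyBoundLocalGibbs`, `TangentEntropyBoundUniformGibbs` (posited; the old forms with the extra hypotheses
  `∀ z, 0 < z → IsHardSphereGibbs 1 z θ⁻¹ u₀ G → density G = ENNReal.ofReal (σ ^ 3) →` inserted after `IsTranslationInvariant G →`),
* the monotonicity `tangentEntropyBoundLocalGibbs_of_local`, `tangentEntropyBoundUniformGibbs_of_uniform` (the old forms imply the
  new ones: more hypotheses),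
* and the glue `tangentEntropyLowDensity_of_localLimitGibbs : Georgii1995_hardSphereCanonicalLocalLimit → TangentEntropyBoundLocalGibbs →
  TangentEntropyLowDensity` (PROVED, as `tangentEntropyLowDensity_of_localLimit` with the Gibbs data of Georgii's limit passed through;
  activity `z ≤ 2σ³` by the landed single-site bound `stub_activityBound`, p149989).

The affinity reduction `TangentEntropyBoundUniformGibbs → TangentEntropyBoundLocalGibbs` is in …KiferEntropyBoundGibbsAffinity.lean.
References: S. Olla, S. R. S. Varadhan, H.-T. Yau, Comm. Math. Phys. 155 (1993) Lemma 4.2; H.-O. Georgii, J. Stat. Phys. 80 (1995)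
Thms 3.3–3.4; D. Ruelle, Statistical Mechanics (1969) §3.4, §4.2.
-/

noncomputable section

open MeasureTheory ProbabilityTheory Set Filter Topology InformationTheory
open scoped ENNReal NNReal

namespace Summit.AtomisticToContinuum.HydrodynamicLimit.Theorems.KiferCompactification

open Literature.MathematicalPhysics.KineticTheory (T3 V3 hsDiameter localGibbsLaw blowUpPoint blowUp
  Georgii1995_hardSphereCanonicalLocalLimit)
open Literature.MathematicalPhysics.KineticTheory.PointProcess (laplaceFunctional specificRelEntropy windowLaw density)
open Literature.Analysis.FluidPDE (HardSphereFlow Config IsHardSphereGibbs IsTranslationInvariant)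
open Literature.Analysis.FunctionSpaces (PointConfig)

/-! ## The Gibbs-reference forms -/

/-- **F2 IN LOCAL-LIMIT FORM, GIBBS REFERENCE** (posited): as `TangentEntropyBoundLocal`, but the translation-invariant probability
reference `G` — the setwise local limit along `ι` of the x-averaged blown-up canonical laws — is moreover known to be a DLR Gibbs
state `IsHardSphereGibbs 1 z θ⁻¹ u₀ G` of some activity `z > 0` and of density `σ³` (both supplied by Georgii's equivalence of
ensembles at the call site): `specificRelEntropy μ G ≤ (∫φ)⁻¹ · σ³ · liminf_k (N(ι k)+1)⁻¹ KL(Q(ι k) ‖ G_{N(ι k)})`. -/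
def TangentEntropyBoundLocalGibbs : Prop :=
  ∃ σ₂ : ℝ, 0 < σ₂ ∧
  ∀ (σ a θ : ℝ) (u₀ : V3) (κ : ℝ), 0 < σ → σ < σ₂ → 0 < a → 0 < θ → 0 < κ →
  ∀ (φ : T3 → ℝ), Continuous φ → (∀ x, 0 ≤ φ x) → (∀ x, φ x ≤ 1) → 0 < ∫ x, φ x →
  ∀ (N : ℕ → ℕ)
    (Φ : ∀ k, HardSphereFlow (Literature.Analysis.FluidPDE.Torus.geometry (Fin 3)) (hsDiameter σ (N k)) (N k + 1))
    (Q : ∀ k, Measure (Config (N k + 1) (Fin 3) T3)),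
    IsTangentFamily σ a θ u₀ κ N Φ Q →
    ∀ (ι : ℕ → ℕ) (μ : Measure (PointConfig (V3 × V3))), IsTangentState σ φ N Q ι μ →
      IsProbabilityMeasure μ → IsTranslationInvariant μ →
    ∀ (G : Measure (PointConfig (V3 × V3))), IsProbabilityMeasure G → IsTranslationInvariant G →
      ∀ z : ℝ, 0 < z → IsHardSphereGibbs 1 z θ⁻¹ u₀ G → density G = ENNReal.ofReal (σ ^ 3) →
      (∀ Λ : Set V3, MeasurableSet Λ → Bornology.IsBounded Λ → ∀ A : Set (PointConfig (V3 × V3)), MeasurableSet A →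
        Tendsto (fun k => windowLaw Λ
            (((volume : Measure T3).prod
              (localGibbsLaw σ (fun _ => a) (fun _ => u₀) (fun _ => θ) (N (ι k)) (Φ (ι k)))).map
              (fun p => blowUp (hsDiameter σ (N (ι k))) p.1 p.2)) A)
          atTop (𝓝 (windowLaw Λ G A))) →
      specificRelEntropy μ G ≤ ENNReal.ofReal ((∫ x, φ x)⁻¹ * σ ^ 3 *
        liminf (fun k => ((N (ι k) + 1 : ℕ) : ℝ)⁻¹ *
          (InformationTheory.klDiv (Q (ι k))
            (localGibbsLaw σ (fun _ => a) (fun _ => u₀) (fun _ => θ) (N (ι k)) (Φ (ι k)))).toReal) atTop)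

/-- **F2 IN LOCAL-LIMIT FORM FOR THE UNIT WEIGHT, GIBBS REFERENCE** (posited; the residual entropy debt in Gibbs-reference form):
as `TangentEntropyBoundUniform` with the same two extra hypotheses on the reference. -/
def TangentEntropyBoundUniformGibbs : Prop :=
  ∃ σ₂ : ℝ, 0 < σ₂ ∧
  ∀ (σ a θ : ℝ) (u₀ : V3) (κ : ℝ), 0 < σ → σ < σ₂ → 0 < a → 0 < θ → 0 < κ →
  ∀ (N : ℕ → ℕ)
    (Φ : ∀ k, HardSphereFlow (Literature.Analysis.FluidPDE.Torus.geometry (Fin 3)) (hsDiameter σ (N k)) (N k + 1))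
    (Q : ∀ k, Measure (Config (N k + 1) (Fin 3) T3)),
    IsTangentFamily σ a θ u₀ κ N Φ Q →
    ∀ (ι : ℕ → ℕ) (μ : Measure (PointConfig (V3 × V3))), IsTangentState σ (fun _ => (1 : ℝ)) N Q ι μ →
      IsProbabilityMeasure μ → IsTranslationInvariant μ →
    ∀ (G : Measure (PointConfig (V3 × V3))), IsProbabilityMeasure G → IsTranslationInvariant G →
      ∀ z : ℝ, 0 < z → IsHardSphereGibbs 1 z θ⁻¹ u₀ G → density G = ENNReal.ofReal (σ ^ 3) →
      (∀ Λ : Set V3, MeasurableSet Λ → Bornology.IsBounded Λ → ∀ A : Set (PointConfig (V3 × V3)), MeasurableSet A →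
        Tendsto (fun k => windowLaw Λ
            (((volume : Measure T3).prod
              (localGibbsLaw σ (fun _ => a) (fun _ => u₀) (fun _ => θ) (N (ι k)) (Φ (ι k)))).map
              (fun p => blowUp (hsDiameter σ (N (ι k))) p.1 p.2)) A)
          atTop (𝓝 (windowLaw Λ G A))) →
      specificRelEntropy μ G ≤ ENNReal.ofReal (σ ^ 3 *
        liminf (fun k => ((N (ι k) + 1 : ℕ) : ℝ)⁻¹ *
          (InformationTheory.klDiv (Q (ι k))
            (localGibbsLaw σ (fun _ => a) (fun _ => u₀) (fun _ => θ) (N (ι k)) (Φ (ι k)))).toReal) atTop)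

/-! ## Monotonicity: the Gibbs-free forms imply the Gibbs-reference forms -/

/-- The Gibbs-free local-limit bound implies its Gibbs-reference form (the extra hypotheses are simply not used). -/
theorem tangentEntropyBoundLocalGibbs_of_local (h : TangentEntropyBoundLocal) : TangentEntropyBoundLocalGibbs := by
  obtain ⟨σ₂, hσ₂, h⟩ := h
  refine ⟨σ₂, hσ₂, ?_⟩
  intro σ a θ u₀ κ hσ hσlt ha hθ hκ φ hφ hφ0 hφ1 hφi N Φ Q hfam ι μ hμ hμP hμT G hGP hGT _z _hz _hG _hGd hloc
  exact h σ a θ u₀ κ hσ hσlt ha hθ hκ φ hφ hφ0 hφ1 hφi N Φ Q hfam ι μ hμ hμP hμT G hGP hGT hloc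

/-- The Gibbs-free unit-weight bound implies its Gibbs-reference form. -/
theorem tangentEntropyBoundUniformGibbs_of_uniform (h : TangentEntropyBoundUniform) : TangentEntropyBoundUniformGibbs := by
  obtain ⟨σ₂, hσ₂, h⟩ := h
  refine ⟨σ₂, hσ₂, ?_⟩
  intro σ a θ u₀ κ hσ hσlt ha hθ hκ N Φ Q hfam ι μ hμ hμP hμT G hGP hGT _z _hz _hG _hGd hloc
  exact h σ a θ u₀ κ hσ hσlt ha hθ hκ N Φ Q hfam ι μ hμ hμP hμT G hGP hGT hloc

/-! ## The glue to the consumer -/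

/-- **The low-density entropy stub from Georgii's local limit and the GIBBS-REFERENCE local-limit bound.** As
`tangentEntropyLowDensity_of_localLimit`: below `min σ₂ (1/8)`, pass to a subsequence `r₀` realising the `liminf` of the normalised
entropies, then to Georgii's subsequence `κ'` with local limit `G` — translation-invariant, Gibbs of activity `z > 0`, of density
`σ³` — and apply the bound to `μ` as a tangent state of the reindexed family, WITH the Gibbs data of `G`; finally `z ≤ 2σ³` by
`stub_activityBound` (density `σ³ ≤ 1/512 ≤ 1/128`). -/
theorem tangentEntropyLowDensity_of_localLimitGibbs (hE : Georgii1995_hardSphereCanonicalLocalLimit)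
    (hL : TangentEntropyBoundLocalGibbs) : TangentEntropyLowDensity := by
  obtain ⟨σ₂, hσ₂, hL⟩ := hL
  refine ⟨min σ₂ (1 / 8), lt_min hσ₂ (by norm_num), ?_⟩
  intro σ a θ u₀ κ hσ hσlt ha hθ hκ φ hφ hφ0 hφ1 hφi N Φ Q hfam ι μ hμ hμP hμT
  have hσ₂' : σ < σ₂ := hσlt.trans_le (min_le_left _ _)
  have hσ8 : σ < 1 / 8 := hσlt.trans_le (min_le_right _ _)
  have hσhalf : σ ≤ 1 / 2 := by linarith
  -- the entropy sequence `u k ∈ [0, κ]`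
  set u : ℕ → ℝ := fun k => ((N (ι k) + 1 : ℕ) : ℝ)⁻¹ *
      (InformationTheory.klDiv (Q (ι k))
        (localGibbsLaw σ (fun _ => a) (fun _ => u₀) (fun _ => θ) (N (ι k)) (Φ (ι k)))).toReal with hu
  have hu0 : ∀ k, 0 ≤ u k := fun k => mul_nonneg (inv_nonneg.2 (Nat.cast_nonneg _)) ENNReal.toReal_nonneg
  have huκ : ∀ k, u k ≤ κ := by
    intro k
    have hKL := hfam.2.2.1 (ι k)
    have h1 : (InformationTheory.klDiv (Q (ι k))
        (localGibbsLaw σ (fun _ => a) (fun _ => u₀) (fun _ => θ) (N (ι k)) (Φ (ι k)))).toReal ≤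
        κ * (N (ι k) + 1) := by
      have h := ENNReal.toReal_mono ENNReal.ofReal_ne_top hKL
      rwa [ENNReal.toReal_ofReal (by positivity)] at h
    have hn : (0 : ℝ) < ((N (ι k) + 1 : ℕ) : ℝ) := by positivity
    rw [hu]
    simp only
    rw [inv_mul_le_iff₀ hn]
    calc _ ≤ κ * (N (ι k) + 1) := h1
      _ = ((N (ι k) + 1 : ℕ) : ℝ) * κ := by push_cast; ring
  -- Step 1: a subsequence realising the liminf
  obtain ⟨r₀, hr₀, hr₀lim⟩ := exists_strictMono_tendsto_liminf hu0 huκ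
  have hι : StrictMono ι := hμ.1
  -- Step 2: Georgii's local limit along a further subsequence
  have hN' : Tendsto (fun j => N (ι (r₀ j))) atTop atTop := by
    refine tendsto_atTop_mono (fun j => ?_) tendsto_id
    exact ((hι.comp hr₀).id_le j).trans (hfam.1 _)
  obtain ⟨κ', hκ', z, G, hz, hG, hGT, hGd, hconv⟩ :=
    hE σ a θ u₀ hσ hσhalf ha hθ (fun j => N (ι (r₀ j))) (fun j => Φ (ι (r₀ j))) hN'
  -- Step 3: the reindexed family and `μ` as its tangent state along `id`
  have hs : StrictMono fun k => ι (r₀ (κ' k)) := hι.comp (hr₀.comp hκ')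
  have hfam' := isTangentFamily_reindex hfam hs
  have hμ' : IsTangentState σ φ (fun k => N (ι (r₀ (κ' k)))) (fun k => Q (ι (r₀ (κ' k)))) id μ := by
    refine ⟨strictMono_id, fun f hf hfc hf0 => ?_⟩
    exact (hμ.2 f hf hfc hf0).comp ((hr₀.comp hκ').tendsto_atTop)
  -- Step 4: the Gibbs-reference local-limit entropy bound along the reindexed family
  have hbound := hL σ a θ u₀ κ hσ hσ₂' ha hθ hκ φ hφ hφ0 hφ1 hφi (fun k => N (ι (r₀ (κ' k))))
    (fun k => Φ (ι (r₀ (κ' k)))) (fun k => Q (ι (r₀ (κ' k)))) hfam' id μ hμ' hμP hμT G hG.1 hGT z hz hG hGd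
    (fun Λ hΛ hΛb A hA => hconv Λ hΛ hΛb A hA)
  -- Step 5: the activity bound and the value of the liminf along the sub-subsequence
  have hσ3 : σ ^ 3 ≤ 1 / 128 := by
    have h3 : σ ^ 3 ≤ (1 / 8) * (1 / 8) * (1 / 8) := by
      calc σ ^ 3 = σ * σ * σ := by ring
        _ ≤ (1 / 8) * (1 / 8) * (1 / 8) := by gcongr
    linarith
  have hz2 : z ≤ 2 * σ ^ 3 := stub_activityBound z θ u₀ G (σ ^ 3) hz hθ hG hGT hGd (by positivity) hσ3
  have hlim : liminf (fun k => u (r₀ (κ' k))) atTop = liminf u atTop :=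
    (hr₀lim.comp hκ'.tendsto_atTop).liminf_eq
  refine ⟨z, G, hz, hz2, hG, hGT, hbound.trans (le_of_eq ?_)⟩
  rw [← hlim]
  rfl

end Summit.AtomisticToContinuum.HydrodynamicLimit.Theorems.KiferCompactification

end
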